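import Summits.ValiantsHypothesis.ValiantsHypothesis.Theorems.MonotoneRestorationOrbitRestorationQPValueOrbitProducts
import Summits.ValiantsHypothesis.ValiantsHypothesis.Theorems.MonotoneRestorationOrbitRestorationQPValueOrbit
import HarnessLib

/-!
# Wide derivations: sums are free, products cost the orbit of the operand multiset (ORBIT currency, XI)

Route MonotoneRestoration, crux `OrbitRestorationQP` (stmt-ValiantsHypothesis-18293), namespace
`Summit.ValiantsHypothesis.ValiantsHypothesis.Theorems.WideDerivation`.  Route-independent (no `Theses` import).

The definitive form of value-orbit symmetrisation.  A WIDE DERIVATION is a value derivation with products of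
ANY fan-in (a multiset of earlier values).  Its `Γ`-ORBIT WIDTH is `≤ B` if every value has `Γ`-orbit `≤ B` and
every product step's operand MULTISET has `Γ`-orbit `≤ B` (`OrbitWidthLE`).  Then (`exists_symmetric_of_wide`)
the derived invariant polynomial has a `Γ`-symmetric circuit with `ORB ≤ B²`: sums cost nothing, products
cost only the orbit of their operand multiset — not of the partial products (Newton, `…ValueOrbitProducts.lean`).
The converse (a symmetric circuit of orbit size `B` is a wide derivation of width `≤ B`, verbatim: gate values
and children multisets move with the gates) is in `…ValueOrbitWideConverse.lean`.

* `WStep`, `WStep.Valid`, `WideDerivation`, `OrbitWidthLE`;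
* `ValueDerivation.empty`, `extend` (one wide step, total), `extendList`, `levels` (rank by rank);
* `exists_valueDerivation_of_wide` — a wide derivation of width `≤ B` yields a (binary-product) value
  derivation with all value orbits `≤ B` containing all its values; `exists_symmetric_of_wide`.

Everything is proved. [folklore]
-/

noncomputable section

open scoped Classical

-- `Summit.ValiantsHypothesis.ValiantsHypothesis.…` is the tree's single-conjunct layout (Sub = Summit).
set_option linter.dupNamespace false

namespace Summit.ValiantsHypothesis.ValiantsHypothesis.Theorems

universe u v

/-- **One step of a wide derivation**: variable, constant, weighted sum of any fan-in, or PRODUCT OF ANY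
FAN-IN (a multiset of earlier values). [folklore] -/
inductive WStep (K : Type u) (X : Type v) [CommSemiring K] : Type (max u v)
  /-- The variable `x`. -/
  | var (x : X) : WStep K X
  /-- The constant `c`. -/
  | const (c : K) : WStep K X
  /-- The weighted sum `Σ_{(c,u) ∈ D} c · u`. -/
  | sum (D : Multiset (K × MvPolynomial X K)) : WStep K X
  /-- The product `Π M` of a multiset of values. -/
  | prod (M : Multiset (MvPolynomial X K)) : WStep K X

namespace WStep

variable {K : Type u} {X : Type v} [CommSemiring K]

/-- The value of a wide step. [folklore] -/
def value : WStep K X → MvPolynomial X K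
  | var x => MvPolynomial.X x
  | const c => MvPolynomial.C c
  | sum D => (D.map fun cu => MvPolynomial.C cu.1 * cu.2).sum
  | prod M => M.prod

/-- The operands of a wide step. [folklore] -/
def args : WStep K X → Multiset (MvPolynomial X K)
  | var _ => 0
  | const _ => 0
  | sum D => D.map Prod.snd
  | prod M => M

/-- Validity of a wide step for `q` in `S` under the rank `r`. [folklore] -/
structure Valid (S : Finset (MvPolynomial X K)) (r : MvPolynomial X K → ℕ) (q : MvPolynomial X K)
    (d : WStep K X) : Prop where
  /-- The step computes `q`. -/
  value_eq : d.value = q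
  /-- The operands are values of smaller rank. -/
  args_lt : ∀ u ∈ d.args, u ∈ S ∧ r u < r q

end WStep

/-- **A wide derivation**: values with a rank, each derived by a valid wide step. [folklore] -/
structure WideDerivation (K : Type u) (X : Type v) [CommSemiring K] where
  /-- The values. -/
  S : Finset (MvPolynomial X K)
  /-- The rank. -/
  rank : MvPolynomial X K → ℕ
  /-- Every value is derived by a valid wide step. -/
  step : ∀ q ∈ S, ∃ d : WStep K X, d.Valid S rank q

namespace WideDerivation

variable {K : Type u} {X : Type v} [Field K]
variable {Γ : Type} [Group Γ] [Fintype Γ] [MulAction Γ X]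

variable (Γ) in
/-- **Orbit width `≤ B`**: every value has `Γ`-orbit `≤ B`, and every value has a valid wide step whose
operand multiset, if it is a product step, has `Γ`-orbit `≤ B`. [folklore] -/
def OrbitWidthLE (𝒲 : WideDerivation K X) (B : ℕ) : Prop :=
  ∀ q ∈ 𝒲.S, (Set.range fun γ : Γ => ren γ q).ncard ≤ B ∧
    ∃ d : WStep K X, d.Valid 𝒲.S 𝒲.rank q ∧
      ∀ M, d = WStep.prod M → (Set.range fun γ : Γ => M.map (ren γ)).ncard ≤ B

/-! ### Extending a value derivation by one wide step -/

/-- The empty value derivation. [folklore] -/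
def _root_.Summit.ValiantsHypothesis.ValiantsHypothesis.Theorems.ValueDerivation.empty : ValueDerivation K X where
  S := ∅
  rank := fun _ => 0
  step := fun q hq => absurd hq (Finset.notMem_empty q)

/-- The indexed family of a multiset (through its list). [folklore] -/
def fam (M : Multiset (MvPolynomial X K)) : Unit → Fin M.toList.length → MvPolynomial X K :=
  fun _ i => M.toList.get i

omit [Field K] in
/-- The multiset of the family of `M` is `M`. [folklore] -/
theorem univ_map_fam [CommSemiring K] (M : Multiset (MvPolynomial X K)) :
    (Finset.univ : Finset (Fin M.toList.length)).val.map (fun i => M.toList.get i) = M := by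
  rw [Fin.univ_def]
  change Multiset.map (fun i => M.toList.get i) (List.finRange M.toList.length : Multiset _) = M
  rw [Multiset.map_coe, ← List.ofFn_eq_map, List.ofFn_get, Multiset.coe_toList]

/-- **Extension by one wide step** (total: unchanged if an operand is missing). [folklore] -/
def extend [CharZero K] (𝒟 : ValueDerivation K X) : WStep K X → ValueDerivation K X
  | WStep.var x => 𝒟.adjoin (StepData.var x) (by simp [StepData.args])
  | WStep.const c => 𝒟.adjoin (StepData.const c) (by simp [StepData.args])
  | WStep.sum D =>
    if h : ∀ u ∈ D.map Prod.snd, u ∈ 𝒟.S then 𝒟.adjoin (StepData.sum D) (by simpa [StepData.args] using h)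
    else 𝒟
  | WStep.prod M =>
    if h : ∀ u ∈ M, u ∈ 𝒟.S then
      ValueProducts.prodAdjoin (fam M) 𝒟 (fun _ i => h _ (Multiset.mem_toList.1 (List.get_mem _ _)))
    else 𝒟

variable [CharZero K]

/-- Extension only adds values. [folklore] -/
theorem mem_extend_of_mem (𝒟 : ValueDerivation K X) (d : WStep K X) {q : MvPolynomial X K} (hq : q ∈ 𝒟.S) :
    q ∈ (extend 𝒟 d).S := by
  cases d with
  | var x => simp only [extend]; exact ValueDerivation.mem_adjoin_S.2 (Or.inr hq)
  | const c => simp only [extend]; exact ValueDerivation.mem_adjoin_S.2 (Or.inr hq)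
  | sum D =>
    simp only [extend]
    split_ifs
    · exact ValueDerivation.mem_adjoin_S.2 (Or.inr hq)
    · exact hq
  | prod M =>
    simp only [extend]
    split_ifs
    · exact ValueProducts.mem_prodAdjoin_S_of_mem _ _ _ hq
    · exact hq

/-- Extension by a step whose operands are present adds the step's value. [folklore] -/
theorem value_mem_extend (𝒟 : ValueDerivation K X) (d : WStep K X) (hd : ∀ u ∈ d.args, u ∈ 𝒟.S) :
    d.value ∈ (extend 𝒟 d).S := by
  cases d with
  | var x => simp only [extend]; exact ValueDerivation.mem_adjoin_S.2 (Or.inl rfl)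
  | const c => simp only [extend]; exact ValueDerivation.mem_adjoin_S.2 (Or.inl rfl)
  | sum D =>
    simp only [extend, dif_pos (show ∀ u ∈ D.map Prod.snd, u ∈ 𝒟.S from hd)]
    exact ValueDerivation.mem_adjoin_S.2 (Or.inl rfl)
  | prod M =>
    simp only [extend, dif_pos (show ∀ u ∈ M, u ∈ 𝒟.S from hd)]
    have := ValueProducts.prod_mem_prodAdjoin_S (fam M) 𝒟
      (fun _ i => hd _ (Multiset.mem_toList.1 (List.get_mem _ _))) ()
    rwa [Finset.prod_eq_multiset_prod, show (Finset.univ.val.map fun i => fam M () i) = M from univ_map_fam M]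
      at this

/-- Extension preserves an orbit bound, given the bound for the new value and — for a product step — for
the operand multiset. [folklore] -/
theorem orbit_extend_le (𝒟 : ValueDerivation K X) (d : WStep K X) {B : ℕ}
    (hS : ∀ q ∈ 𝒟.S, (Set.range fun γ : Γ => ren γ q).ncard ≤ B)
    (hv : (Set.range fun γ : Γ => ren γ d.value).ncard ≤ B)
    (hM : ∀ M, d = WStep.prod M → (Set.range fun γ : Γ => M.map (ren γ)).ncard ≤ B)
    {q : MvPolynomial X K} (hq : q ∈ (extend 𝒟 d).S) : (Set.range fun γ : Γ => ren γ q).ncard ≤ B := by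
  cases d with
  | var x =>
    simp only [extend] at hq
    rcases ValueDerivation.mem_adjoin_S.1 hq with rfl | hq
    · exact hv
    · exact hS q hq
  | const c =>
    simp only [extend] at hq
    rcases ValueDerivation.mem_adjoin_S.1 hq with rfl | hq
    · exact hv
    · exact hS q hq
  | sum D =>
    simp only [extend] at hq
    split_ifs at hq
    · rcases ValueDerivation.mem_adjoin_S.1 hq with rfl | hq
      · exact hv
      · exact hS q hq
    · exact hS q hq
  | prod M =>
    simp only [extend] at hq
    split_ifs at hq
    · refine ValueProducts.orbit_prodAdjoin_le (fam M) 𝒟 _ hS (fun _ => ?_) hq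
      rw [show (Finset.univ.val.map (fam M ())) = M from univ_map_fam M]
      exact hM M rfl
    · exact hS q hq

/-! ### Iterated extension -/

/-- Extension by a list of wide steps. [folklore] -/
def extendList (𝒟 : ValueDerivation K X) (l : List (WStep K X)) : ValueDerivation K X := l.foldl extend 𝒟

/-- Iterated extension only adds values. [folklore] -/
theorem mem_extendList_of_mem (l : List (WStep K X)) :
    ∀ (𝒟 : ValueDerivation K X) {q : MvPolynomial X K}, q ∈ 𝒟.S → q ∈ (extendList 𝒟 l).S := by
  induction l with
  | nil => intro 𝒟 q hq; exact hq
  | cons d l ih => intro 𝒟 q hq; exact ih (extend 𝒟 d) (mem_extend_of_mem 𝒟 d hq)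

/-- Iterated extension adds the value of every listed step whose operands were present at the start.
[folklore] -/
theorem value_mem_extendList (l : List (WStep K X)) :
    ∀ (𝒟 : ValueDerivation K X) (d : WStep K X), d ∈ l → (∀ u ∈ d.args, u ∈ 𝒟.S) →
      d.value ∈ (extendList 𝒟 l).S := by
  induction l with
  | nil => intro 𝒟 d hd; simp at hd
  | cons d' l ih =>
    intro 𝒟 d hd hargs
    rcases List.mem_cons.1 hd with rfl | hd
    · exact mem_extendList_of_mem l _ (value_mem_extend 𝒟 d hargs)
    · exact ih (extend 𝒟 d') d hd fun u hu => mem_extend_of_mem 𝒟 d' (hargs u hu)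

/-- Iterated extension preserves an orbit bound, given the bounds for the listed steps. [folklore] -/
theorem orbit_extendList_le (l : List (WStep K X)) {B : ℕ}
    (hl : ∀ d ∈ l, (Set.range fun γ : Γ => ren γ d.value).ncard ≤ B ∧
      ∀ M, d = WStep.prod M → (Set.range fun γ : Γ => M.map (ren γ)).ncard ≤ B) :
    ∀ (𝒟 : ValueDerivation K X), (∀ q ∈ 𝒟.S, (Set.range fun γ : Γ => ren γ q).ncard ≤ B) →
      ∀ q ∈ (extendList 𝒟 l).S, (Set.range fun γ : Γ => ren γ q).ncard ≤ B := by
  induction l with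
  | nil => intro 𝒟 hS q hq; exact hS q hq
  | cons d l ih =>
    intro 𝒟 hS q hq
    refine ih (fun d' hd' => hl d' (List.mem_cons_of_mem _ hd')) (extend 𝒟 d) ?_ q hq
    exact fun q' hq' => orbit_extend_le 𝒟 d hS (hl d List.mem_cons_self).1 (hl d List.mem_cons_self).2 hq'

/-! ### Rank by rank -/

variable (𝒲 : WideDerivation K X) {B : ℕ} (hW : 𝒲.OrbitWidthLE Γ B)

/-- The chosen wide step of a value (from the width hypothesis). [folklore] -/
def wstep (q : MvPolynomial X K) : WStep K X :=
  if h : q ∈ 𝒲.S then (hW q h).2.choose else WStep.const 0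

omit [Fintype Γ] [CharZero K] in
/-- The chosen step is valid. [folklore] -/
theorem wstep_valid {q : MvPolynomial X K} (hq : q ∈ 𝒲.S) : (wstep 𝒲 hW q).Valid 𝒲.S 𝒲.rank q := by
  rw [wstep, dif_pos hq]; exact (hW q hq).2.choose_spec.1

omit [Fintype Γ] [CharZero K] in
/-- The chosen step's product multiset has small orbit. [folklore] -/
theorem wstep_prod {q : MvPolynomial X K} (hq : q ∈ 𝒲.S) :
    ∀ M, wstep 𝒲 hW q = WStep.prod M → (Set.range fun γ : Γ => M.map (ren γ)).ncard ≤ B := by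
  rw [wstep, dif_pos hq]; exact (hW q hq).2.choose_spec.2

/-- The chosen steps of the values of rank `r`. [folklore] -/
def level (r : ℕ) : List (WStep K X) := ((𝒲.S.filter fun q => 𝒲.rank q = r).toList).map (wstep 𝒲 hW)

/-- The value derivations obtained rank by rank. [folklore] -/
def levels : ℕ → ValueDerivation K X
  | 0 => ValueDerivation.empty
  | r + 1 => extendList (levels r) (level 𝒲 hW r)

/-- **Invariant**: after `r` levels every value of rank `< r` is present and all orbits are `≤ B`. [folklore] -/
theorem levels_spec :
    ∀ r : ℕ, (∀ q ∈ 𝒲.S, 𝒲.rank q < r → q ∈ (levels 𝒲 hW r).S) ∧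
      ∀ q ∈ (levels 𝒲 hW r).S, (Set.range fun γ : Γ => ren γ q).ncard ≤ B := by
  intro r
  induction r with
  | zero =>
    exact ⟨fun q _ h => absurd h (Nat.not_lt_zero _), fun q hq => absurd hq (Finset.notMem_empty q)⟩
  | succ r ih =>
    obtain ⟨ih1, ih2⟩ := ih
    refine ⟨fun q hq hqr => ?_, ?_⟩
    · rcases Nat.lt_succ_iff_lt_or_eq.1 hqr with hlt | heq
      · exact mem_extendList_of_mem _ _ (ih1 q hq hlt)
      · have hval := (wstep_valid 𝒲 hW hq).value_eq
        rw [← hval]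
        refine value_mem_extendList (level 𝒲 hW r) (levels 𝒲 hW r) (wstep 𝒲 hW q) ?_ fun u hu => ?_
        · exact List.mem_map.2 ⟨q, Finset.mem_toList.2 (Finset.mem_filter.2 ⟨hq, heq⟩), rfl⟩
        · obtain ⟨huS, hlt⟩ := (wstep_valid 𝒲 hW hq).args_lt u hu
          exact ih1 u huS (heq ▸ hlt)
    · refine orbit_extendList_le (level 𝒲 hW r) (fun d hd => ?_) (levels 𝒲 hW r) ih2
      obtain ⟨q, hq, rfl⟩ := List.mem_map.1 hd
      have hqS : q ∈ 𝒲.S := (Finset.mem_filter.1 (Finset.mem_toList.1 hq)).1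
      refine ⟨?_, wstep_prod 𝒲 hW hqS⟩
      rw [(wstep_valid 𝒲 hW hqS).value_eq]
      exact (hW q hqS).1

include hW in
/-- **A wide derivation of orbit width `≤ B` yields a value derivation (binary products) containing all its
values, with all value orbits `≤ B`.** [folklore] -/
theorem exists_valueDerivation_of_wide :
    ∃ 𝒟 : ValueDerivation K X, (∀ q ∈ 𝒲.S, q ∈ 𝒟.S) ∧
      ∀ q ∈ 𝒟.S, (Set.range fun γ : Γ => ren γ q).ncard ≤ B := by
  refine ⟨levels 𝒲 hW (𝒲.S.sup 𝒲.rank + 1), fun q hq => ?_, (levels_spec 𝒲 hW _).2⟩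
  exact (levels_spec 𝒲 hW _).1 q hq (Nat.lt_succ_of_le (Finset.le_sup (f := 𝒲.rank) hq))

include hW in
open Literature.Computability.AlgebraicComplexity in
/-- **WIDE VALUE-ORBIT SYMMETRISATION.**  An invariant `f` with a wide derivation (weighted sums and
PRODUCTS of any fan-in, any length) of `Γ`-orbit width `≤ B` — every value has orbit `≤ B`, every product
step's operand MULTISET has orbit `≤ B` — has a `Γ`-symmetric circuit with `ORB ≤ B²`.  Sums are free;
products cost only the orbit of their operand multiset. [folklore] -/
theorem exists_symmetric_of_wide [Fintype X] {f : MvPolynomial X K} (hf : f ∈ 𝒲.S) (hB : 1 ≤ B)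
    (hfix : ∀ γ : Γ, ren γ f = f) (hX : ∀ x : X, (Set.range fun γ : Γ => γ • x).ncard ≤ B) :
    ∃ (G : Type (max u v)) (_ : Fintype G) (C : LabelledArithCircuit K X Unit G),
      C.IsSymmetric Γ ∧ C.eval (C.output ()) = f ∧ C.orbitSize Γ ≤ B * B := by
  obtain ⟨𝒟, hsub, hS⟩ := exists_valueDerivation_of_wide 𝒲 hW
  exact 𝒟.exists_symmetric_of_valueDerivation (hsub f hf) hB hfix hX hS

end WideDerivation

end Summit.ValiantsHypothesis.ValiantsHypothesis.Theorems

end
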